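import Summits.Parity.GeneralizedHardyLittlewood.Theorems.BeyondDiagonalBeatsQuarter.CornerMoebius
import Summits.Parity.GeneralizedHardyLittlewood.Theorems.BeyondDiagonalBeatsQuarter.CornerSums
import Summits.Parity.GeneralizedHardyLittlewood.Theorems.BeyondDiagonalBeatsQuarter.MellinBumpMoebius
import HarnessLib

/-!
# Route `PrimeLevelFamEdge`, crux K_A `MomentsBeyondDiagonal` (stmt-Parity-20007), line «petersson_layers» v4, stub `stub_diag`:
# **the log saving of the Selberg-coordinate coefficients with the EXPONENT AS A PARAMETER** — `|A_n(y)| ≤ C_A·D(n)/(1+log y)^A`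

First item of the repair census for rung `N ≥ 3` of `stub_diag`
(`Cruxes/MomentsBeyondDiagonal/Lines/petersson_layers_stub_diag_g13_R22.md`): the remainder estimate of order `(i,j)` has budget
`(log q̂)^{i+j−3}` while its inner sum carries `Λ^{2(i+j)+4}`, so the fixed log-saving exponent `12` of K_B's
`…Corner.abs_sum_copTauW_le` (p622004) closes the assembly only for `i + j ≤ 4`. The de la Vallée-Poussin rate gives EVERY exponent;
this file re-runs the chain of `…BeyondDiagonalBeatsQuarter.CornerMoebius` verbatim with `12 ↦ A`, `13 ↦ A+1`:

* (`…MellinBump.abs_moebiusDivSum_le` — `Σ_{k≤e} μ(k)/k ≪_A (1+log e)^{−A}`, already in the tree);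
* `abs_moebiusSqSum_le_pow` — `|Σ_{de≤z} μ(d)μ(e)/(de)| ≤ C_A/(1+log z)^A`;
* `inv_log_pow_le_rpow_mul_pow` — `1/(1+log(y/m))^A ≤ m^{1/8}(2^A/(1+log y)^A + y^{−1/16})`;
* `abs_sum_copTauW_le_pow` — **`|A_n(y)| ≤ C_A·D(n)/(1+log y)^A` for all `y ≥ 1`, `n ≥ 1`, every `A`.**

Def-free; theorems only. Helper `--supports stmt-Parity-20007`; closes nothing; K_A, K_B and the Parity summit are NOT proved;
nothing about Landau–Siegel zeros.

## References
* H. L. Montgomery, R. C. Vaughan, Multiplicative Number Theory I, CUP 2007, §8.1 (8.6).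
  [cite: MontgomeryVaughan2007, §8.1 (8.6) — derivation (twisted 1/ζ² partial sums, any power of log)]
-/

noncomputable section

open scoped Real ArithmeticFunction.Moebius
open Finset ArithmeticFunction

namespace Summit.Parity.GeneralizedHardyLittlewood.Theorems.MomentsBeyondDiagonal.DiagCorner

open Literature.NumberTheory.LFunctions Literature.NumberTheory.LFunctions.KMV2000
open MollifierMainTerm (W G invA)
open Literature.Barriers.Parity (Icc_one_eq_Ioc_zero)
open Summit.Parity.GeneralizedHardyLittlewood.Theorems.BeyondDiagonalBeatsQuarter.KernelFormXSq
open Summit.Parity.GeneralizedHardyLittlewood.Theorems.BeyondDiagonalBeatsQuarter.Corner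
open Summit.Parity.GeneralizedHardyLittlewood.Theorems.BeyondDiagonalBeatsQuarter (MellinBump.abs_moebiusDivSum_le)

/-- **`|Σ_{de ≤ z} μ(d)μ(e)/(de)| ≤ C_A/(1 + log z)^A` for `z ≥ 1`**, every `A` (hyperbola at `u = ⌊√z⌋` as in
`…Corner.abs_moebiusSqSum_le`, with the rate `(1+log)^{−(A+1)}`). [cite: MontgomeryVaughan2007, §8.1 (8.6) — derivation (hyperbola for 1/ζ²)] -/
theorem abs_moebiusSqSum_le_pow (A : ℕ) :
    ∃ C : ℝ, 0 < C ∧ ∀ z : ℝ, 1 ≤ z →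
      |∑ d ∈ Ioc 0 ⌊z⌋₊, ∑ e ∈ Ioc 0 (⌊z⌋₊ / d), (μ d : ℝ) / d * ((μ e : ℝ) / e)| ≤
        C / (1 + Real.log z) ^ A := by
  obtain ⟨C₀, hC₀, h0⟩ := MellinBump.abs_moebiusDivSum_le (A + 1)
  refine ⟨(C₀ * 4 ^ (A + 1)) ^ 2 + 16 * (C₀ * 4 ^ (A + 1)), by positivity, fun z hz ↦ ?_⟩
  have hz0 : 0 < z := by linarith
  set L : ℝ := Real.log z with hLdef
  have hL : 0 ≤ L := Real.log_nonneg hz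
  obtain ⟨hu1, huu, hZu⟩ := floor_sqrt_facts hz
  set u : ℕ := ⌊Real.sqrt z⌋₊ with hudef
  set Z : ℕ := ⌊z⌋₊ with hZdef
  have hZz : (Z : ℝ) ≤ z := Nat.floor_le hz0.le
  have hu0 : (0 : ℝ) < u := by exact_mod_cast hu1
  have huuz : (u : ℝ) * u ≤ z := by
    have : ((u * u : ℕ) : ℝ) ≤ Z := by exact_mod_cast huu
    push_cast at this; linarith
  have huz : (u : ℝ) ≤ z := by nlinarith
  have hlogu : (1 + L) / 4 ≤ 1 + Real.log (u : ℝ) := one_add_log_le_floor_sqrt hz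
  have hloguL : Real.log (u : ℝ) ≤ L := Real.log_le_log hu0 huz
  -- uniform bound on `m(e)` for `e ≥ u`
  set m : ℕ → ℝ := fun e ↦ ∑ k ∈ Icc 1 e, (μ k : ℝ) / k with hmdef
  set η : ℝ := C₀ * 4 ^ (A + 1) / (1 + L) ^ (A + 1) with hηdef
  have hη0 : 0 ≤ η := by positivity
  have hm0 : ∀ e : ℕ, u ≤ e → |m e| ≤ η := by
    intro e hue
    have he1 : 1 ≤ e := hu1.trans hue
    have hle : 1 + Real.log (u : ℝ) ≤ 1 + Real.log (e : ℝ) := by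
      have := Real.log_le_log hu0 (show (u : ℝ) ≤ e by exact_mod_cast hue); linarith
    calc |m e| ≤ C₀ / (1 + Real.log (e : ℝ)) ^ (A + 1) := h0 e he1
      _ ≤ C₀ / ((1 + L) / 4) ^ (A + 1) := by
          apply div_le_div_of_nonneg_left hC₀.le (by positivity)
          exact pow_le_pow_left₀ (by positivity) (hlogu.trans hle) (A + 1)
      _ = η := by
          rw [hηdef]; field_simp
          rw [div_pow, div_mul_cancel₀ _ (pow_ne_zero _ (by norm_num : (4 : ℝ) ≠ 0))]
  set g : ℕ → ℝ := fun n ↦ (μ n : ℝ) / n with hgdef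
  have hgle : ∀ n : ℕ, |g n| ≤ (n : ℝ)⁻¹ := by
    intro n
    rcases Nat.eq_zero_or_pos n with rfl | hn
    · simp [hgdef]
    · rw [hgdef]; dsimp only
      rw [abs_div, abs_of_pos (by exact_mod_cast hn : (0 : ℝ) < n), div_eq_mul_inv]
      have : |(μ n : ℝ)| ≤ 1 := by exact_mod_cast ArithmeticFunction.abs_moebius_le_one
      exact mul_le_of_le_one_left (by positivity) this
  -- hyperbola split
  have hsym := sum_hyperbola_symm (fun d e ↦ g d * g e) (fun d e ↦ by ring) huu hZu
  have hF : ∀ d e : ℕ, (μ d : ℝ) / d * ((μ e : ℝ) / e) = g d * g e := fun d e ↦ rfl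
  simp only [hF]
  rw [hsym]
  -- the box equals `m(u)²`
  have hbox : ∑ d ∈ Ioc 0 u, ∑ e ∈ Ioc 0 u, g d * g e = m u * m u := by
    rw [Finset.sum_mul_sum, Icc_one_eq_Ioc_zero]
  -- the tail, term by term in `d`
  have htail : ∀ d ∈ Ioc 0 u, |∑ e ∈ Ioc u (Z / d), g d * g e| ≤ (d : ℝ)⁻¹ * (2 * η) := by
    intro d hd
    have hd' := Finset.mem_Ioc.1 hd
    have huZd : u ≤ Z / d :=
      (Nat.le_div_iff_mul_le hd'.1).2 (le_trans (Nat.mul_le_mul_left u hd'.2) huu)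
    have hsplit : ∑ e ∈ Ioc u (Z / d), g d * g e = g d * (m (Z / d) - m u) := by
      rw [← Finset.mul_sum]
      congr 1
      simp only [hmdef]
      rw [Icc_one_eq_Ioc_zero, Icc_one_eq_Ioc_zero, ← Finset.sum_Ioc_consecutive _ (Nat.zero_le u) huZd]
      ring
    rw [hsplit, abs_mul]
    refine mul_le_mul (hgle d) ?_ (abs_nonneg _) (by positivity)
    calc |m (Z / d) - m u| ≤ |m (Z / d)| + |m u| := abs_sub _ _
      _ ≤ η + η := add_le_add (hm0 _ huZd) (hm0 _ le_rfl)
      _ = 2 * η := by ring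
  have hharm : ∑ d ∈ Icc 1 u, ((d : ℝ))⁻¹ ≤ 1 + Real.log u := by
    have h := harmonic_le_one_add_log u
    simpa [harmonic_eq_sum_Icc, Rat.cast_sum, Rat.cast_inv, Rat.cast_natCast] using h
  have htail' : |∑ d ∈ Ioc 0 u, ∑ e ∈ Ioc u (Z / d), g d * g e| ≤ (1 + L) * (2 * η) := by
    refine (Finset.abs_sum_le_sum_abs _ _).trans ((Finset.sum_le_sum htail).trans ?_)
    rw [← Finset.sum_mul, ← Icc_one_eq_Ioc_zero]
    calc (∑ d ∈ Icc 1 u, (d : ℝ)⁻¹) * (2 * η) ≤ (1 + Real.log (u : ℝ)) * (2 * η) :=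
          mul_le_mul_of_nonneg_right hharm (by positivity)
      _ ≤ (1 + L) * (2 * η) := by gcongr
  have hmu : |m u| ≤ η := hm0 u le_rfl
  have h1L : 1 ≤ 1 + L := by linarith
  have hη1 : η ≤ C₀ * 4 ^ (A + 1) / (1 + L) ^ A := by
    rw [hηdef]
    apply div_le_div_of_nonneg_left (by positivity) (by positivity)
    exact pow_le_pow_right₀ h1L (Nat.le_succ A)
  have hη2 : η ≤ C₀ * 4 ^ (A + 1) := by
    rw [hηdef]; exact div_le_self (by positivity) (one_le_pow₀ h1L)
  have hη3 : (1 + L) * η = C₀ * 4 ^ (A + 1) / (1 + L) ^ A := by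
    rw [hηdef]; field_simp; ring
  calc |∑ d ∈ Ioc 0 u, ∑ e ∈ Ioc 0 u, g d * g e + 2 * ∑ d ∈ Ioc 0 u, ∑ e ∈ Ioc u (Z / d), g d * g e|
      ≤ |∑ d ∈ Ioc 0 u, ∑ e ∈ Ioc 0 u, g d * g e| +
          |2 * ∑ d ∈ Ioc 0 u, ∑ e ∈ Ioc u (Z / d), g d * g e| := abs_add_le _ _
    _ ≤ η * η + 2 * ((1 + L) * (2 * η)) := by
        rw [hbox, abs_mul, abs_mul, abs_two]
        exact add_le_add (mul_le_mul hmu hmu (abs_nonneg _) hη0)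
          (mul_le_mul_of_nonneg_left htail' zero_le_two)
    _ = η * η + 4 * ((1 + L) * η) := by ring
    _ ≤ (C₀ * 4 ^ (A + 1)) * (C₀ * 4 ^ (A + 1) / (1 + L) ^ A) + 4 * (C₀ * 4 ^ (A + 1) / (1 + L) ^ A) := by
        rw [hη3]
        exact add_le_add (mul_le_mul hη2 hη1 hη0 (by positivity)) le_rfl
    _ = ((C₀ * 4 ^ (A + 1)) ^ 2 + 4 * (C₀ * 4 ^ (A + 1))) / (1 + L) ^ A := by ring
    _ ≤ ((C₀ * 4 ^ (A + 1)) ^ 2 + 16 * (C₀ * 4 ^ (A + 1))) / (1 + L) ^ A := by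
        apply div_le_div_of_nonneg_right _ (by positivity)
        nlinarith [hC₀]

/-- For `1 ≤ m ≤ y`: `1/(1 + log(y/m))^A ≤ m^{1/8}·(2^A/(1 + log y)^A + y^{−1/16})` (split at `m = √y`). [folklore] -/
theorem inv_log_pow_le_rpow_mul_pow (A : ℕ) {y : ℝ} (hy : 1 ≤ y) {m : ℕ} (hm1 : 1 ≤ m) (hmy : (m : ℝ) ≤ y) :
    1 / (1 + Real.log (y / m)) ^ A ≤
      (m : ℝ) ^ (1 / 8 : ℝ) * ((2 : ℝ) ^ A / (1 + Real.log y) ^ A + y ^ (-(1 / 16 : ℝ))) := by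
  have hy0 : 0 < y := by linarith
  have hm0 : (0 : ℝ) < m := by exact_mod_cast hm1
  have hm1' : (1 : ℝ) ≤ m := by exact_mod_cast hm1
  have hym : 1 ≤ y / m := by rw [le_div_iff₀ hm0]; linarith
  have hL : 0 ≤ Real.log y := Real.log_nonneg hy
  have hLm : 0 ≤ Real.log (y / m) := Real.log_nonneg hym
  have hm8 : 1 ≤ (m : ℝ) ^ (1 / 8 : ℝ) := Real.one_le_rpow hm1' (by norm_num)
  have hA : 0 ≤ (2 : ℝ) ^ A / (1 + Real.log y) ^ A := by positivity
  have hB : 0 ≤ y ^ (-(1 / 16 : ℝ)) := by positivity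
  rcases le_or_gt ((m : ℝ) ^ 2) y with hcase | hcase
  · -- m ≤ √y: log(y/m) ≥ ½ log y
    have hlog : Real.log y ≤ 2 * Real.log (y / m) := by
      rw [Real.log_div hy0.ne' hm0.ne']
      have : 2 * Real.log m ≤ Real.log y := by
        have h2 : Real.log ((m : ℝ) ^ 2) = 2 * Real.log m := by
          rw [Real.log_pow]; norm_num
        rw [← h2]; exact Real.log_le_log (by positivity) hcase
      linarith
    have h1 : 1 + Real.log y ≤ 2 * (1 + Real.log (y / m)) := by linarith
    have h2 : 1 / (1 + Real.log (y / m)) ^ A ≤ (2 : ℝ) ^ A / (1 + Real.log y) ^ A := by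
      rw [div_le_div_iff₀ (by positivity) (by positivity), one_mul, ← mul_pow]
      exact pow_le_pow_left₀ (by positivity) h1 A
    calc 1 / (1 + Real.log (y / m)) ^ A ≤ (2 : ℝ) ^ A / (1 + Real.log y) ^ A := h2
      _ ≤ 1 * ((2 : ℝ) ^ A / (1 + Real.log y) ^ A + y ^ (-(1 / 16 : ℝ))) := by linarith
      _ ≤ (m : ℝ) ^ (1 / 8 : ℝ) * ((2 : ℝ) ^ A / (1 + Real.log y) ^ A + y ^ (-(1 / 16 : ℝ))) :=
          mul_le_mul_of_nonneg_right hm8 (by positivity)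
  · -- m > √y: m^{1/8} y^{-1/16} ≥ 1
    have h1 : 1 / (1 + Real.log (y / m)) ^ A ≤ 1 := by
      rw [div_le_one (by positivity)]
      exact one_le_pow₀ (by linarith)
    have h2 : 1 ≤ (m : ℝ) ^ (1 / 8 : ℝ) * y ^ (-(1 / 16 : ℝ)) := by
      have hy16 : y ^ (-(1 / 16 : ℝ)) = (y ^ (1 / 16 : ℝ))⁻¹ := Real.rpow_neg hy0.le _
      have hypos : 0 < y ^ (1 / 16 : ℝ) := by positivity
      rw [hy16, ← div_eq_mul_inv, le_div_iff₀ hypos, one_mul]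
      have : y ^ (1 / 16 : ℝ) ≤ ((m : ℝ) ^ 2) ^ (1 / 16 : ℝ) :=
        Real.rpow_le_rpow hy0.le hcase.le (by norm_num)
      refine this.trans (le_of_eq ?_)
      rw [← Real.rpow_natCast, ← Real.rpow_mul hm0.le]
      norm_num
    calc 1 / (1 + Real.log (y / m)) ^ A ≤ 1 := h1
      _ ≤ (m : ℝ) ^ (1 / 8 : ℝ) * y ^ (-(1 / 16 : ℝ)) := h2
      _ ≤ (m : ℝ) ^ (1 / 8 : ℝ) * ((2 : ℝ) ^ A / (1 + Real.log y) ^ A + y ^ (-(1 / 16 : ℝ))) := by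
          apply mul_le_mul_of_nonneg_left _ (by positivity); linarith

/-- **`|A_n(y)| ≤ C_A·D(n)/(1 + log y)^A`** for `y ≥ 1`, `n ≥ 1`, every `A` — the twisted coprime sums
`Σ_{k ≤ y, (k,n)=1} μ(k)τ(k)/(kψ(k))` at any power-of-log rate, uniformly in `n` up to `D(n) = Σ_{d∣n} d^{−3/4}`.
[cite: MontgomeryVaughan2007, §8.1 (8.6) — derivation (twisted 1/ζ² partial sums, uniform in the coprimality modulus)] -/
theorem abs_sum_copTauW_le_pow (A : ℕ) :
    ∃ C : ℝ, 0 < C ∧ ∀ n : ℕ, n ≠ 0 → ∀ y : ℝ, 1 ≤ y →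
      |∑ k ∈ Icc 1 ⌊y⌋₊, copTauW n k| ≤ C * divWeight n / (1 + Real.log y) ^ A := by
  obtain ⟨C_M, hC_M, hM⟩ := abs_moebiusSqSum_le_pow A
  obtain ⟨C_h, hC_h, hH⟩ := tsum_abs_hloc_mul_rpow_le
  obtain ⟨C₁₆, hC₁₆, h16⟩ := rpow_neg_le_div_log_pow (show (0 : ℝ) < 1 / 16 by norm_num) A
  refine ⟨C_M * C_h * ((2 : ℝ) ^ A + C₁₆), by positivity, fun n hn y hy ↦ ?_⟩
  have hy0 : 0 < y := by linarith
  set N : ℕ := ⌊y⌋₊ with hN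
  set L : ℝ := Real.log y with hLdef
  have hL : 0 ≤ L := Real.log_nonneg hy
  set D : ℝ := divWeight n with hDdef
  have hD0 : 0 ≤ D := divWeight_nonneg n
  have hHn : ∑' m : ℕ, |hloc n m| * (m : ℝ) ^ (1 / 8 : ℝ) ≤ C_h * D := by
    have := hH n hn; simpa [hDdef, divWeight] using this
  have hsw := summable_abs_hloc_mul_rpow hn
  rw [sum_copTauW_eq_sum_hloc]
  -- termwise bound
  have hterm : ∀ m ∈ Icc 1 N, |hloc n m *
      ∑ d ∈ Ioc 0 ⌊y / m⌋₊, ∑ e ∈ Ioc 0 (⌊y / m⌋₊ / d), (μ d : ℝ) / d * ((μ e : ℝ) / e)| ≤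
      (|hloc n m| * (m : ℝ) ^ (1 / 8 : ℝ)) * (C_M * ((2 : ℝ) ^ A / (1 + L) ^ A + y ^ (-(1 / 16 : ℝ)))) := by
    intro m hm
    have hm' := Finset.mem_Icc.1 hm
    have hm0 : (0 : ℝ) < m := by exact_mod_cast hm'.1
    have hmy : (m : ℝ) ≤ y := le_trans (by exact_mod_cast hm'.2) (Nat.floor_le hy0.le)
    have hym : 1 ≤ y / m := by rw [le_div_iff₀ hm0]; linarith
    rw [abs_mul]
    have h1 := hM (y / m) hym
    have h2 := inv_log_pow_le_rpow_mul_pow A hy hm'.1 hmy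
    calc |hloc n m| * |∑ d ∈ Ioc 0 ⌊y / m⌋₊, ∑ e ∈ Ioc 0 (⌊y / m⌋₊ / d), (μ d : ℝ) / d * ((μ e : ℝ) / e)|
        ≤ |hloc n m| * (C_M / (1 + Real.log (y / m)) ^ A) :=
          mul_le_mul_of_nonneg_left h1 (abs_nonneg _)
      _ = |hloc n m| * C_M * (1 / (1 + Real.log (y / m)) ^ A) := by ring
      _ ≤ |hloc n m| * C_M *
          ((m : ℝ) ^ (1 / 8 : ℝ) * ((2 : ℝ) ^ A / (1 + L) ^ A + y ^ (-(1 / 16 : ℝ)))) :=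
          mul_le_mul_of_nonneg_left h2 (by positivity)
      _ = (|hloc n m| * (m : ℝ) ^ (1 / 8 : ℝ)) *
          (C_M * ((2 : ℝ) ^ A / (1 + L) ^ A + y ^ (-(1 / 16 : ℝ)))) := by ring
  have hfin : ∑ m ∈ Icc 1 N, |hloc n m| * (m : ℝ) ^ (1 / 8 : ℝ) ≤ C_h * D := by
    refine le_trans ?_ hHn
    exact hsw.sum_le_tsum _ (fun m _ ↦ by positivity)
  calc |∑ m ∈ Icc 1 N, hloc n m *
          ∑ d ∈ Ioc 0 ⌊y / m⌋₊, ∑ e ∈ Ioc 0 (⌊y / m⌋₊ / d), (μ d : ℝ) / d * ((μ e : ℝ) / e)|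
      ≤ ∑ m ∈ Icc 1 N, |hloc n m *
          ∑ d ∈ Ioc 0 ⌊y / m⌋₊, ∑ e ∈ Ioc 0 (⌊y / m⌋₊ / d), (μ d : ℝ) / d * ((μ e : ℝ) / e)| :=
        Finset.abs_sum_le_sum_abs _ _
    _ ≤ ∑ m ∈ Icc 1 N, (|hloc n m| * (m : ℝ) ^ (1 / 8 : ℝ)) *
          (C_M * ((2 : ℝ) ^ A / (1 + L) ^ A + y ^ (-(1 / 16 : ℝ)))) := Finset.sum_le_sum hterm
    _ = (∑ m ∈ Icc 1 N, |hloc n m| * (m : ℝ) ^ (1 / 8 : ℝ)) *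
          (C_M * ((2 : ℝ) ^ A / (1 + L) ^ A + y ^ (-(1 / 16 : ℝ)))) := by rw [Finset.sum_mul]
    _ ≤ (C_h * D) * (C_M * ((2 : ℝ) ^ A / (1 + L) ^ A + C₁₆ / (1 + L) ^ A)) := by
        refine mul_le_mul hfin ?_ (by positivity) (by positivity)
        exact mul_le_mul_of_nonneg_left (by linarith [h16 y hy]) hC_M.le
    _ = C_M * C_h * ((2 : ℝ) ^ A + C₁₆) * D / (1 + L) ^ A := by
        field_simp

end Summit.Parity.GeneralizedHardyLittlewood.Theorems.MomentsBeyondDiagonal.DiagCorner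

end
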